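import Mathlib.Analysis.Complex.ExponentialBounds
import Mathlib.Data.Nat.Choose.Bounds
import Mathlib.Algebra.Order.Field.GeomSum
import Mathlib.Algebra.BigOperators.Intervals
import HarnessLib

/-!
# Numerics for the local sparsity of random lifts

Topic `Literature/Combinatorics/SimpleGraph`.  Pure real arithmetic closing the first-moment count
of `LiftSparsity.lean` (`card_denseLifts_mul_le`): with `q ≥ 1` (sparsity `ε = 1/q`), base order
`w ≥ 1`, fibre size `a` and size bound `ℓ` with `16 q (16 w)^q ℓ ≤ a`, writing `j_u = u + u/q + 1`
(the least integer `> (1 + 1/q) u`),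

  `∑_{u=1}^{ℓ} C(wa, u) · C(u², j_u) / (a - j_u)^{j_u} ≤ 1/4`        (`sparsity_sum_le`).

Steps: `C(wa,u) ≤ (wa)^u/u!`, `C(u², j) ≤ u^{2j}/j!`, `j! ≥ u!(u+1)^{u/q+1}`, `u^{2u} ≤ 8^u (u!)²`
(`u^u/u! ≤ e^u`, `e² < 8`), `(a-j)^{-j} ≤ (2/a)^j`, giving the term bound `(16w)^u (2u/a)^{u/q+1}`
(`term_le`); then `u ↦ u/q` is `q`-to-one and the geometric series in `ρ = (16w)^q · 2ℓ/a ≤ 1/(8q)`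
sums to `≤ (8/7) qρ ≤ 1/7`.  Used for the random-graph input of Conneryd–Ghannane–Pang 2025, Thm. 6.1.

## References

* [folklore] first-moment numerics.
* [ConnerydGhannanePang2025] arXiv:2511.17272, Lemma 6.4 (the statement these numerics serve).
-/

namespace Literature.Combinatorics.SimpleGraph

open Finset

/-! ### Elementary bounds -/

/-- `u^u ≤ e^u · u!`. [folklore] -/
theorem pow_self_le_exp_mul_factorial (u : ℕ) : (u : ℝ) ^ u ≤ Real.exp u * u.factorial := by
  have h := Real.pow_div_factorial_le_exp (u : ℝ) (Nat.cast_nonneg u) u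
  rwa [div_le_iff₀ (by positivity)] at h

/-- `u^{2u} ≤ 8^u (u!)²`. [folklore] -/
theorem pow_two_mul_self_le (u : ℕ) : (u : ℝ) ^ (2 * u) ≤ 8 ^ u * (u.factorial : ℝ) ^ 2 := by
  have h := pow_self_le_exp_mul_factorial u
  have he : Real.exp (u : ℝ) ≤ (2.72 : ℝ) ^ u := by
    rw [← Real.exp_one_rpow, Real.rpow_natCast]
    exact pow_le_pow_left₀ (Real.exp_pos 1).le (Real.exp_one_lt_d9.le.trans (by norm_num)) u
  calc (u : ℝ) ^ (2 * u) = ((u : ℝ) ^ u) ^ 2 := by rw [pow_mul']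
    _ ≤ (Real.exp u * u.factorial) ^ 2 := pow_le_pow_left₀ (by positivity) h 2
    _ ≤ ((2.72 : ℝ) ^ u * u.factorial) ^ 2 := by gcongr
    _ = ((2.72 : ℝ) ^ 2) ^ u * (u.factorial : ℝ) ^ 2 := by rw [mul_pow, ← pow_mul, mul_comm u 2, pow_mul]
    _ ≤ 8 ^ u * (u.factorial : ℝ) ^ 2 := by gcongr; norm_num

/-- The key polynomial inequality: `u^{2j} 2^u ≤ 16^u u^{s+1} u! j!` for `j = u + s + 1`. [folklore] -/
theorem key_ineq (u s : ℕ) :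
    (u : ℝ) ^ (2 * (u + s + 1)) * 2 ^ u ≤
      16 ^ u * (u : ℝ) ^ (s + 1) * u.factorial * (u + s + 1).factorial := by
  have h5 := pow_two_mul_self_le u
  have h4 : (u.factorial : ℝ) * (u : ℝ) ^ (s + 1) ≤ (u + s + 1).factorial := by
    have h := @Nat.factorial_mul_pow_le_factorial u (s + 1)
    rw [show u + (s + 1) = u + s + 1 by omega] at h
    have h' : (u.factorial : ℝ) * ((u : ℝ) + 1) ^ (s + 1) ≤ (u + s + 1).factorial := by exact_mod_cast h
    refine le_trans ?_ h'
    gcongr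
    linarith
  calc (u : ℝ) ^ (2 * (u + s + 1)) * 2 ^ u
      = ((u : ℝ) ^ (2 * u) * 2 ^ u) * (u : ℝ) ^ (s + 1) * (u : ℝ) ^ (s + 1) := by ring
    _ ≤ (8 ^ u * (u.factorial : ℝ) ^ 2 * 2 ^ u) * (u : ℝ) ^ (s + 1) * (u : ℝ) ^ (s + 1) := by gcongr
    _ = 16 ^ u * (u : ℝ) ^ (s + 1) * u.factorial * ((u.factorial : ℝ) * (u : ℝ) ^ (s + 1)) := by
        rw [show (16 : ℝ) ^ u = 8 ^ u * 2 ^ u by rw [← mul_pow]; norm_num]; ring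
    _ ≤ 16 ^ u * (u : ℝ) ^ (s + 1) * u.factorial * (u + s + 1).factorial := by gcongr

/-- **The term bound**: for `1 ≤ u`, `j = u + s + 1` with `2j ≤ a`,
`C(wa, u) · C(u², j) / (a - j)^j ≤ (16 w)^u · (2u/a)^{s+1}`. [folklore] -/
theorem term_le {w a u s : ℕ} (hu : 1 ≤ u) (hja : 2 * (u + s + 1) ≤ a) :
    ((w * a).choose u : ℝ) * ((u ^ 2).choose (u + s + 1) : ℝ) / ((a : ℝ) - (u + s + 1 : ℕ)) ^ (u + s + 1) ≤
      (16 * w : ℝ) ^ u * (2 * u / a : ℝ) ^ (s + 1) := by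
  set j := u + s + 1 with hj
  have ha : (0 : ℝ) < a := by exact_mod_cast (by omega : 0 < a)
  have hu0 : (0 : ℝ) < u := by exact_mod_cast hu
  have haj : (a : ℝ) / 2 ≤ (a : ℝ) - (j : ℕ) := by
    have : ((2 * j : ℕ) : ℝ) ≤ a := by exact_mod_cast hja
    push_cast at this
    linarith
  have haj0 : (0 : ℝ) < (a : ℝ) - (j : ℕ) := lt_of_lt_of_le (by positivity) haj
  -- Steps 1–3
  have h1 : ((w * a).choose u : ℝ) ≤ ((w * a : ℕ) : ℝ) ^ u / u.factorial := Nat.choose_le_pow_div u (w * a)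
  have h2 : ((u ^ 2).choose j : ℝ) ≤ ((u ^ 2 : ℕ) : ℝ) ^ j / j.factorial := Nat.choose_le_pow_div j (u ^ 2)
  have h3 : 1 / ((a : ℝ) - (j : ℕ)) ^ j ≤ (2 / a) ^ j := by
    calc 1 / ((a : ℝ) - (j : ℕ)) ^ j ≤ 1 / ((a : ℝ) / 2) ^ j :=
          one_div_le_one_div_of_le (by positivity) (pow_le_pow_left₀ (by positivity) haj j)
      _ = (2 / a) ^ j := by rw [one_div, ← inv_pow, inv_div]
  have hfu : (0 : ℝ) < u.factorial := by positivity
  have hfj : (0 : ℝ) < j.factorial := by positivity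
  have key := key_ineq u s
  rw [← hj] at key
  calc ((w * a).choose u : ℝ) * ((u ^ 2).choose j : ℝ) / ((a : ℝ) - (j : ℕ)) ^ j
      = ((w * a).choose u : ℝ) * ((u ^ 2).choose j : ℝ) * (1 / ((a : ℝ) - (j : ℕ)) ^ j) := by ring
    _ ≤ (((w * a : ℕ) : ℝ) ^ u / u.factorial) * (((u ^ 2 : ℕ) : ℝ) ^ j / j.factorial) * (2 / a) ^ j := by
        gcongr
    _ = ((w : ℝ) ^ u * (a : ℝ) ^ u * (u : ℝ) ^ (2 * j) * 2 ^ j) / (u.factorial * j.factorial * (a : ℝ) ^ j) := by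
        push_cast
        rw [div_pow, mul_pow, ← pow_mul]
        field_simp
    _ ≤ ((w : ℝ) ^ u * (a : ℝ) ^ u * (16 ^ u * (u : ℝ) ^ (s + 1) * u.factorial * j.factorial) * 2 ^ (s + 1)) /
          (u.factorial * j.factorial * (a : ℝ) ^ j) := by
        gcongr ?_ / _
        calc (w : ℝ) ^ u * (a : ℝ) ^ u * (u : ℝ) ^ (2 * j) * 2 ^ j
            = (w : ℝ) ^ u * (a : ℝ) ^ u * ((u : ℝ) ^ (2 * j) * 2 ^ u) * 2 ^ (s + 1) := by rw [hj]; ring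
          _ ≤ (w : ℝ) ^ u * (a : ℝ) ^ u * (16 ^ u * (u : ℝ) ^ (s + 1) * u.factorial * j.factorial) * 2 ^ (s + 1) := by
              gcongr
    _ = (16 * w : ℝ) ^ u * (2 * u / a : ℝ) ^ (s + 1) := by
        rw [hj, div_pow, mul_pow, mul_pow, pow_add (a : ℝ) (u + s) 1, pow_add (a : ℝ) u s, pow_succ (a : ℝ) s]
        field_simp

/-! ### Summation -/

/-- Grouping `u` by `u / q`: `∑_{u=1}^{ℓ} ρ^{u/q+1} ≤ q · ρ/(1-ρ)` for `0 ≤ ρ < 1`. [folklore] -/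
theorem sum_pow_div_le {q ℓ : ℕ} (hq : 1 ≤ q) {ρ : ℝ} (hρ0 : 0 ≤ ρ) (hρ1 : ρ < 1) :
    ∑ u ∈ Finset.Icc 1 ℓ, ρ ^ (u / q + 1) ≤ q * (ρ / (1 - ρ)) := by
  set S := ℓ / q with hS
  have hsub : Finset.Icc 1 ℓ ⊆ Finset.range (q * (S + 1)) := by
    intro u hu
    rw [Finset.mem_Icc] at hu
    rw [Finset.mem_range]
    exact lt_of_le_of_lt hu.2 (Nat.lt_mul_div_succ ℓ hq)
  have hblocks : ∀ n, ∑ u ∈ Finset.range (q * n), ρ ^ (u / q + 1) = q * ∑ s ∈ Finset.range n, ρ ^ (s + 1) := by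
    intro n
    induction n with
    | zero => simp
    | succ n ih =>
      rw [Nat.mul_succ, Finset.sum_range_add, ih, Finset.sum_range_succ, mul_add]
      congr 1
      rw [Finset.sum_congr rfl fun x hx => by
        rw [show (q * n + x) / q = n by
          rw [Nat.mul_add_div hq, Nat.div_eq_of_lt (Finset.mem_range.1 hx), add_zero]]]
      rw [Finset.sum_const, Finset.card_range, nsmul_eq_mul]
  calc ∑ u ∈ Finset.Icc 1 ℓ, ρ ^ (u / q + 1)
      ≤ ∑ u ∈ Finset.range (q * (S + 1)), ρ ^ (u / q + 1) :=
        Finset.sum_le_sum_of_subset_of_nonneg hsub fun _ _ _ => by positivity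
    _ = q * ∑ s ∈ Finset.range (S + 1), ρ ^ (s + 1) := hblocks (S + 1)
    _ ≤ q * (ρ / (1 - ρ)) := by
        refine mul_le_mul_of_nonneg_left ?_ (Nat.cast_nonneg q)
        have h := geom_sum_Ico_le_of_lt_one (m := 1) (n := S + 2) hρ0 hρ1
        rw [pow_one] at h
        refine le_trans (le_of_eq ?_) h
        rw [Finset.sum_Ico_eq_sum_range, show S + 2 - 1 = S + 1 by norm_num]
        exact Finset.sum_congr rfl fun s _ => by rw [add_comm]

/-- **The sparsity numerics**: with `16 q (16 w)^q ℓ ≤ a`,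
`∑_{u=1}^{ℓ} C(wa, u) · C(u², j_u) / (a - j_u)^{j_u} ≤ 1/4`, `j_u = u + u/q + 1`. [folklore] -/
theorem sparsity_sum_le {w q a ℓ : ℕ} (hq : 1 ≤ q) (hw : 1 ≤ w)
    (hℓa : 16 * q * (16 * w) ^ q * ℓ ≤ a) (ha : 1 ≤ a) :
    ∑ u ∈ Finset.Icc 1 ℓ, ((w * a).choose u : ℝ) * ((u ^ 2).choose (u + u / q + 1) : ℝ) /
        ((a : ℝ) - (u + u / q + 1 : ℕ)) ^ (u + u / q + 1) ≤ 1 / 4 := by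
  have ha0 : (0 : ℝ) < a := by exact_mod_cast ha
  have hq0 : (0 : ℝ) < q := by exact_mod_cast hq
  have h16 : (1 : ℝ) ≤ 16 * w := by
    have : (1 : ℝ) ≤ w := by exact_mod_cast hw
    linarith
  -- `ρ = (16w)^q · 2ℓ/a ≤ 1/(8q)`
  set ρ : ℝ := (16 * w : ℝ) ^ q * (2 * ℓ / a) with hρ
  have hρ0 : 0 ≤ ρ := by positivity
  have hρq : ρ ≤ 1 / (8 * q) := by
    have h : ((16 * q * (16 * w) ^ q * ℓ : ℕ) : ℝ) ≤ a := by exact_mod_cast hℓa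
    push_cast at h
    rw [hρ, mul_div_assoc', div_le_div_iff₀ ha0 (by positivity)]
    have : (16 * w : ℝ) ^ q * (2 * ℓ) * (8 * q) = 16 * q * (16 * w : ℝ) ^ q * ℓ := by ring
    rw [this, one_mul]
    exact h
  have hρ8 : ρ ≤ 1 / 8 := hρq.trans (by
    rw [div_le_div_iff₀ (by positivity) (by norm_num)]
    have : (1 : ℝ) ≤ q := by exact_mod_cast hq
    linarith)
  have hρ1 : ρ < 1 := lt_of_le_of_lt hρ8 (by norm_num)
  -- termwise
  have hterm : ∀ u ∈ Finset.Icc 1 ℓ,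
      ((w * a).choose u : ℝ) * ((u ^ 2).choose (u + u / q + 1) : ℝ) /
        ((a : ℝ) - (u + u / q + 1 : ℕ)) ^ (u + u / q + 1) ≤ ρ ^ (u / q + 1) := by
    intro u hu
    rw [Finset.mem_Icc] at hu
    have hja : 2 * (u + u / q + 1) ≤ a := by
      have h1 : u / q ≤ u := Nat.div_le_self u q
      have h2 : 16 * ℓ ≤ 16 * q * (16 * w) ^ q * ℓ := by
        have : 1 ≤ q * (16 * w) ^ q := Nat.one_le_iff_ne_zero.2 (Nat.mul_ne_zero (by omega)
          (pow_ne_zero _ (by omega)))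
        calc 16 * ℓ = 16 * 1 * ℓ := by ring
          _ ≤ 16 * (q * (16 * w) ^ q) * ℓ := Nat.mul_le_mul_right _ (Nat.mul_le_mul_left _ this)
          _ = 16 * q * (16 * w) ^ q * ℓ := by ring
      omega
    refine (term_le hu.1 hja).trans ?_
    have hs : u < q * (u / q + 1) := Nat.lt_mul_div_succ u hq
    calc (16 * w : ℝ) ^ u * (2 * u / a : ℝ) ^ (u / q + 1)
        ≤ (16 * w : ℝ) ^ (q * (u / q + 1)) * (2 * u / a : ℝ) ^ (u / q + 1) :=
          mul_le_mul_of_nonneg_right (pow_le_pow_right₀ h16 hs.le) (by positivity)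
      _ ≤ (16 * w : ℝ) ^ (q * (u / q + 1)) * (2 * ℓ / a : ℝ) ^ (u / q + 1) := by
          refine mul_le_mul_of_nonneg_left (pow_le_pow_left₀ (by positivity) ?_ _) (by positivity)
          gcongr
          exact_mod_cast hu.2
      _ = ρ ^ (u / q + 1) := by
          rw [hρ]
          conv_rhs => rw [mul_pow, ← pow_mul]
  calc ∑ u ∈ Finset.Icc 1 ℓ, ((w * a).choose u : ℝ) * ((u ^ 2).choose (u + u / q + 1) : ℝ) /
        ((a : ℝ) - (u + u / q + 1 : ℕ)) ^ (u + u / q + 1)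
      ≤ ∑ u ∈ Finset.Icc 1 ℓ, ρ ^ (u / q + 1) := Finset.sum_le_sum hterm
    _ ≤ q * (ρ / (1 - ρ)) := sum_pow_div_le hq hρ0 hρ1
    _ ≤ q * ((1 / (8 * q)) / (7 / 8)) :=
        mul_le_mul_of_nonneg_left (div_le_div₀ (by positivity) hρq (by norm_num) (by linarith))
          (Nat.cast_nonneg q)
    _ ≤ 1 / 4 := by
        rw [show (q : ℝ) * (1 / (8 * q) / (7 / 8)) = 1 / 7 by field_simp]
        norm_num

end Literature.Combinatorics.SimpleGraph
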